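import Summits.QuantumFields.YangMills.Theorems.UnitScaleTiltProp7LaplaceAFlatCoercive
import Summits.QuantumFields.YangMills.Theorems.UnitScaleTiltProp7LineAvgSmoothRightInversePi
import HarnessLib

/-!
# Route `UnitScaleTilt`, crux «MinimiserStabilityRegPr» (stmt-QuantumFields-19200), stub `stub_existenceMinimalOrbit` (EX), node N06(d = 3) — FLAT-CERT VECTOR ROAD, FILE V-1a:
# **THE BLOCK-SMOOTH SECTION OF THE TUBE AVERAGE `Q_k(1)` AT THE FLAT MEMBER AND ITS `Δ_a(1)`-ENERGY** — the comparison configuration of [Balaban1985Variational] (45)'s minimum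
# problem «`H` … giving a minimum of the quadratic form `½⟨A, ΔA⟩` under the restrictions `LʲηQ_jA = B`» at `U₀ = 1`, with energy `≤ (c₀∕cB)·ℓ³·(2721600 + a₀)·‖B‖²`

Cell `ym3-torus`, width seat `ym3-torus-px7` (gen 6; WIDTH COPY «width 7» of ym3-torus-p1).  THEOREMS ONLY (0 `def`, 0 `sorry`); `--supports stmt-QuantumFields-19200 --as helper`;
count-neutral.  YM₃ on T³ is ladder rung R3, NOT d = 4, NOT the Clay problem; nothing here claims the stub, the crux, a curved-background row or the mass gap.

WHY (cell context).  The EX display (S31ᴸ ✓`Prop7StubEXOfChartPiecesTwS31L`) carries print's POINTWISE kernel rows `h137kπ`, `h137kΔ`, `hCk` for the letter `KinvT = (Q_kGQ_k†)⁻¹` of brick L0d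
(✓`Prop7SectET3CurvedPropagators`), DISPLAYED as N06 inputs.  Their member-level FLAT certificates (px5 g4∕g5 LOCATEs #56∕#59) run through lit ✓`B9Eq3126QG1QInvPointDecay.norm_bondPoint_Kinv_le`
(Combes–Thomas), whose one missing analytic input at `U₀ = 1` is the FLOOR `μ₁` of `Q_kGQ_k†` — [Balaban1985BackgroundPropagators] (3.126)∕Thm 3.11's lower bound.  Print's road is
variational (`re⟪g, Δ_a⁻¹g⟫ ≥ |⟪f, g⟫|²∕re⟪f, Δ_a f⟫` at a block-SMOOTH comparison field `f` with `Q_k f = Y`; the raw tent `Q_k†Y` will NOT do — it jumps across the transverse block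
faces and its `Δ^η`-energy is `O(ℓ)`).  The comparison field in the route's own letters is ★p1's smooth right inverse of the tube average
✓`Prop7LineAvgSmoothRightInverse.exists_smoothRightInverse_bondAvgIter_pi_T3` (exact `bondAvgIter (K−n) ∘ H = id`, GRADIENT-`ℓ²` row `388800·ℓ³·ℓ⁻²`); this file reads its energy in
brick L0d's `Δ_a(1)` through FILE A ✓`Prop7LaplaceAFlatLetters` and px6 ✓`Prop7LaplaceAFlatCoercive.re_inner_laplaceA`.  FILE V-1b (`…FlatGramFloor`) feeds it to lit's variational floor.

WHAT IS PROVED (ns `…Theorems.Prop7FlatGramSection`; member `F n K`, `n < K`, weights `c₀ cB > 0`, `ℓ := L^{K−n}`, the display's `Q*aQ` weight `a := a₀·(c₀∕cB)·ℓ³`, any real `a₀`).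
* §1 two lattice rows (any `Params`, real scalar bond fields): ★`sum_curl_one_sq_le` `Σ_p (curl 1 f p)² ≤ 4·Σ_bΣ_ρ (f(b+e_ρ) − f b)²`, ★`sum_diverg_one_sq_le` `Σ_x (diverg 1 f x)² ≤ d·Σ_bΣ_ρ (…)²`.
* §2 `norm_RS_le` (`‖R_S‖ ≤ 1`), `map_diverg_one`; ★★`exists_flat_section_energy` — for every block field `y` a fine field `X` with `Q_k(1)(toL2 X) = y` EXACTLY and
  `re⟪toL2 X, Δ_a(1)(toL2 X)⟫ ≤ (c₀∕cB)·ℓ³·(2721600 + a₀)·‖y‖²` (any Hessian slot `Δx` with `Δx 1 = Δ^η(1)`; `2721600 = 7·388800`, the `7 = 4 + 3` of §1 at `d = 3`).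
THE UNITS POINT.  `(c₀∕cB)·ℓ³` is the display's convention (print: `c₀ = η³`, `cB = 1`, so the factor is `1` on print's diagonal), not a `K`-dependence — see FILE V-1b's docstring.
HONEST SCOPE.  `U₀ = 1` only; `L²` statements; crude constants; no claim on any stub ∕ crux ∕ summit statement.

References: T. Bałaban, CMP **102** (1985) 277–309 [Balaban1985Variational] ((45)–(46) p.285, (110) p.294); CMP **99** (1985) 389–434 [Balaban1985BackgroundPropagators] (Thm 3.11 p.416,
(3.8)–(3.11) p.392, (3.21) p.394, (3.26) p.395, (3.126) p.420); CMP **95** (1984) 17–40 [Balaban1984PropagatorsI] ((1.2) p.18, (1.18) p.20, (1.21) p.21).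
-/

set_option autoImplicit false

noncomputable section

open scoped InnerProductSpace ComplexConjugate Matrix.Norms.L2Operator BigOperators

namespace Summit.QuantumFields.YangMills.Theorems.Prop7FlatGramSection

open Literature.MathematicalPhysics.QuantumFieldTheory.Balaban1983to89
open Literature.MathematicalPhysics.QuantumFieldTheory.Balaban1983to89.T3ContinuumYM3Torus
open T3SectALandauChart (eta eta_pos)
open LatticeFieldCalculus (curl diverg bondAvgIter)
open B9Eq311L2Pairing (WL2)
open B11Eq103H1Complex (SiteL2K BondL2K)
open Summit.QuantumFields.YangMills.Theorems.Prop7SectET3Transport (periodsT3)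
open Summit.QuantumFields.YangMills.Theorems.Prop7SectET3HilbertLetters (W₂ toL2 toL2S toL2B DstarL2)
open Summit.QuantumFields.YangMills.Theorems.Prop7SectET3GaugeProjector (RS RS_isSymmetric RS_RS)
open Summit.QuantumFields.YangMills.Theorems.Prop7SectET3WilsonHessian (DeltaEta DeltaEtaSlot DeltaEta_isSymmetric)
open Summit.QuantumFields.YangMills.Theorems.Prop7SectET3CurvedPropagators (Qk laplaceA)
open Summit.QuantumFields.YangMills.Theorems.Prop7LaplaceAFlatLetters
open Summit.QuantumFields.YangMills.Theorems.Prop7LaplaceAFlatCoercive (re_inner_laplaceA)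
open Summit.QuantumFields.YangMills.Theorems.Prop7LineAvgSmoothRightInverse (exists_smoothRightInverse_bondAvgIter_pi_T3)

/-! ## §1 Two lattice rows: the curl and the divergence of a bond field are dominated by its full gradient -/

section Lattice

variable {P : Params} {j : ℕ}

/-- ★ **`Σ_p (curl₁ f)(p)² ≤ 4·Σ_b Σ_ρ (f(b + e_ρ) − f(b))²`** — the plaquette variable `f(x,μ) + f(x+e_μ,ν) − f(x+e_ν,μ) − f(x,ν)` is the difference of two forward differences
(`(∂_μ f_ν)(x) − (∂_ν f_μ)(x)`, [Balaban1984PropagatorsI] (1.2)); each positively oriented plaquette is one triple `(x, μ < ν)`. [folklore] [cite: Balaban1984PropagatorsI, (1.2) p.18, (1.21) p.21] -/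
theorem sum_curl_one_sq_le (f : VecField P j ℝ) :
    ∑ p : Plaq P j, (curl 1 f p) ^ 2 ≤ 4 * ∑ b : PBond P j, ∑ ρ : Fin P.d, (f ⟨b.src.shift ρ, b.dir⟩ - f b) ^ 2 := by
  classical
  -- the full gradient sum as a triple sum over `(x, ρ, ν)`
  set A : Site P j → Fin P.d → Fin P.d → ℝ := fun x ρ ν => (f ⟨x.shift ρ, ν⟩ - f ⟨x, ν⟩) ^ 2 with hA
  have hA0 : ∀ x ρ ν, 0 ≤ A x ρ ν := fun x ρ ν => sq_nonneg _
  have hT : ∑ b : PBond P j, ∑ ρ : Fin P.d, (f ⟨b.src.shift ρ, b.dir⟩ - f b) ^ 2 = ∑ x : Site P j, ∑ ρ : Fin P.d, ∑ ν : Fin P.d, A x ρ ν := by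
    rw [B10StarCount.sum_pbond]
    exact Finset.sum_congr rfl fun x _ => Finset.sum_comm
  -- per plaquette: `(a − b)² ≤ 2a² + 2b²`
  have hp : ∀ p : Plaq P j, (curl 1 f p) ^ 2 ≤ 2 * A p.src p.μ p.ν + 2 * A p.src p.ν p.μ := by
    intro p
    have hc : curl 1 f p = (f ⟨p.src.shift p.μ, p.ν⟩ - f ⟨p.src, p.ν⟩) - (f ⟨p.src.shift p.ν, p.μ⟩ - f ⟨p.src, p.μ⟩) := by
      simp only [curl, one_smul]; ring
    rw [hc, hA]
    nlinarith [sq_nonneg ((f ⟨p.src.shift p.μ, p.ν⟩ - f ⟨p.src, p.ν⟩) + (f ⟨p.src.shift p.ν, p.μ⟩ - f ⟨p.src, p.μ⟩))]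
  -- each of the two plaquette sums is dominated by the full triple sum
  have hsub : ∀ g : Site P j → Fin P.d → Fin P.d → ℝ, (∀ x μ ν, 0 ≤ g x μ ν) →
      ∑ p : Plaq P j, g p.src p.μ p.ν ≤ ∑ x : Site P j, ∑ μ : Fin P.d, ∑ ν : Fin P.d, g x μ ν := by
    intro g hg
    rw [sum_plaq_eq_sum_posPlaq' g]
    calc ∑ q ∈ B9Eq39Adjoint.posPlaq (Site P j) (Fin P.d), g q.1 q.2.1 q.2.2
        ≤ ∑ q : Site P j × Fin P.d × Fin P.d, g q.1 q.2.1 q.2.2 :=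
          Finset.sum_le_sum_of_subset_of_nonneg (Finset.subset_univ _) fun q _ _ => hg _ _ _
      _ = ∑ x : Site P j, ∑ μ : Fin P.d, ∑ ν : Fin P.d, g x μ ν := by
          rw [Fintype.sum_prod_type]
          exact Finset.sum_congr rfl fun x _ => Fintype.sum_prod_type _
  have h1 := hsub A hA0
  have h2 : ∑ p : Plaq P j, A p.src p.ν p.μ ≤ ∑ x : Site P j, ∑ μ : Fin P.d, ∑ ν : Fin P.d, A x μ ν := by
    refine (hsub (fun x μ ν => A x ν μ) fun x μ ν => hA0 x ν μ).trans (le_of_eq ?_)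
    exact Finset.sum_congr rfl fun x _ => Finset.sum_comm
  calc ∑ p : Plaq P j, (curl 1 f p) ^ 2 ≤ ∑ p : Plaq P j, (2 * A p.src p.μ p.ν + 2 * A p.src p.ν p.μ) := Finset.sum_le_sum fun p _ => hp p
    _ = 2 * ∑ p : Plaq P j, A p.src p.μ p.ν + 2 * ∑ p : Plaq P j, A p.src p.ν p.μ := by
        rw [Finset.sum_add_distrib, Finset.mul_sum, Finset.mul_sum]
    _ ≤ 2 * ∑ x : Site P j, ∑ μ : Fin P.d, ∑ ν : Fin P.d, A x μ ν + 2 * ∑ x : Site P j, ∑ μ : Fin P.d, ∑ ν : Fin P.d, A x μ ν := by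
        gcongr
    _ = 4 * ∑ b : PBond P j, ∑ ρ : Fin P.d, (f ⟨b.src.shift ρ, b.dir⟩ - f b) ^ 2 := by rw [hT]; ring

/-- ★ **`Σ_x (∂*₁ f)(x)² ≤ d·Σ_b Σ_ρ (f(b + e_ρ) − f(b))²`** — the divergence `Σ_μ (f(x−e_μ,μ) − f(x,μ))` ([Balaban1984PropagatorsI] (1.21)) by Cauchy–Schwarz over the `d` directions
and the shift bijection `x ↦ x − e_μ`. [folklore] [cite: Balaban1984PropagatorsI, (1.21) p.21] -/
theorem sum_diverg_one_sq_le (f : VecField P j ℝ) :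
    ∑ x : Site P j, (diverg 1 f x) ^ 2 ≤ P.d * ∑ b : PBond P j, ∑ ρ : Fin P.d, (f ⟨b.src.shift ρ, b.dir⟩ - f b) ^ 2 := by
  classical
  -- Cauchy–Schwarz over the directions
  have hcs : ∀ x : Site P j, (diverg 1 f x) ^ 2 ≤ P.d * ∑ μ : Fin P.d, (f ⟨x.unshift μ, μ⟩ - f ⟨x, μ⟩) ^ 2 := by
    intro x
    have hdiv : diverg 1 f x = ∑ μ : Fin P.d, (f ⟨x.unshift μ, μ⟩ - f ⟨x, μ⟩) := by
      simp only [diverg, one_smul]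
    rw [hdiv]
    have h := sq_sum_le_card_mul_sum_sq (s := (Finset.univ : Finset (Fin P.d))) (f := fun μ => f ⟨x.unshift μ, μ⟩ - f ⟨x, μ⟩)
    simpa using h
  -- the shift bijection, direction by direction
  have hshift : ∀ μ : Fin P.d, ∑ x : Site P j, (f ⟨x.unshift μ, μ⟩ - f ⟨x, μ⟩) ^ 2 = ∑ x : Site P j, (f ⟨x.shift μ, μ⟩ - f ⟨x, μ⟩) ^ 2 := by
    intro μ
    refine Fintype.sum_equiv (LatticeFieldCalculus.shiftEquiv μ).symm _ _ fun x => ?_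
    show (f ⟨x.unshift μ, μ⟩ - f ⟨x, μ⟩) ^ 2 = (f ⟨(x.unshift μ).shift μ, μ⟩ - f ⟨x.unshift μ, μ⟩) ^ 2
    rw [B10StarCount.shift_unshift]; ring
  calc ∑ x : Site P j, (diverg 1 f x) ^ 2 ≤ ∑ x : Site P j, (P.d * ∑ μ : Fin P.d, (f ⟨x.unshift μ, μ⟩ - f ⟨x, μ⟩) ^ 2) := Finset.sum_le_sum fun x _ => hcs x
    _ = P.d * ∑ μ : Fin P.d, ∑ x : Site P j, (f ⟨x.shift μ, μ⟩ - f ⟨x, μ⟩) ^ 2 := by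
        rw [← Finset.mul_sum, Finset.sum_comm]; simp only [hshift]
    _ = P.d * ∑ b : PBond P j, (f ⟨b.src.shift b.dir, b.dir⟩ - f b) ^ 2 := by
        rw [B10StarCount.sum_pbond, Finset.sum_comm]
    _ ≤ P.d * ∑ b : PBond P j, ∑ ρ : Fin P.d, (f ⟨b.src.shift ρ, b.dir⟩ - f b) ^ 2 := by
        gcongr with b
        exact Finset.single_le_sum (f := fun ρ => (f ⟨b.src.shift ρ, b.dir⟩ - f b) ^ 2) (fun ρ _ => sq_nonneg _) (Finset.mem_univ b.dir)

end Lattice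

/-! ## §2 The block-smooth section of the tube average `Q_k(1)` and its `Δ_a(1)`-energy -/

section Member

variable {F : T3Family} {n K : ℕ} {c₀ cB : ℝ} [Fact (0 < c₀)] [Fact (0 < cB)]

omit [Fact (0 < cB)] in
/-- `R_S(U₀)` is a contraction: `‖R_S f‖ ≤ ‖f‖` (an orthogonal projection — ✓`RS_isSymmetric`, ✓`RS_RS`). [cite: Balaban1985BackgroundPropagators, (3.21) p.394] -/
theorem norm_RS_le {h : n ≤ K} (U₀ : GaugeField (F.P K) 0 (Matrix.specialUnitaryGroup (Fin 2) ℂ)) (f : SiteL2K ℂ 3 (periodsT3 F K) c₀ W₂) :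
    ‖RS F n K h c₀ cB U₀ f‖ ≤ ‖f‖ := by
  set g := RS F n K h c₀ cB U₀ f with hg
  have hsq : ‖g‖ ^ 2 ≤ ‖f‖ * ‖g‖ := by
    have h1 : ‖g‖ ^ 2 = RCLike.re ⟪f, g⟫_ℂ := by
      rw [@norm_sq_eq_re_inner ℂ, hg, RS_isSymmetric (n := n) (h := h) (cB := cB) U₀ f (RS F n K h c₀ cB U₀ f), RS_RS]
    rw [h1]
    exact re_inner_le_norm f g
  rcases (norm_nonneg g).eq_or_lt with h0 | hpos
  · rw [← h0]; exact norm_nonneg f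
  · nlinarith [norm_nonneg f]

/-- An `ℝ`-linear functional of the `2 × 2` matrix coefficients commutes with the flat divergence `∂*₁` (the divergence is a sum of differences). [folklore]
[cite: Balaban1984PropagatorsI, (1.21) p.21] -/
theorem map_diverg_one {P : Params} {j : ℕ} (φ : Matrix (Fin 2) (Fin 2) ℂ →ₗ[ℝ] ℝ) (X : VecField P j (Matrix (Fin 2) (Fin 2) ℂ)) (x : Site P j) :
    φ (diverg 1 X x) = diverg 1 (fun b => φ (X b)) x := by
  simp only [LatticeFieldCalculus.diverg, map_sum, map_smul, map_sub]

/-- ★★ **THE BLOCK-SMOOTH SECTION OF THE TUBE AVERAGE AT THE FLAT MEMBER AND ITS ENERGY** — for `n < K`, any real `a₀`, any Hessian slot `Δx` with `Δx 1 = Δ^η(1)` and every block field `y`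
there is a fine field `X` with `Q_k(1)(toL2 X) = y` EXACTLY and
`re⟪toL2 X, Δ_a(1)(toL2 X)⟫ ≤ (c₀∕cB)·ℓ³·(2721600 + a₀)·‖y‖²` at the display's weight `a := a₀·(c₀∕cB)·ℓ³` (`ℓ = L^{K−n}`): ★p1's smooth right inverse
✓`exists_smoothRightInverse_bondAvgIter_pi_T3` on the 8 real components, FILE A's flat forms (`Δ^η(1) = c₀η⁻²Σ|curl₁|²`, `D*(1) = η⁻¹∂*₁`, `Q_k(1) = toL2B∘Q_{K−n}`), §1's two lattice
rows and `‖R_S‖ ≤ 1`; `η·ℓ = 1` removes every power of `η`. This is the comparison configuration of [Balaban1985Variational] (45)'s minimum problem at `U₀ = 1`.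
[cite: Balaban1985Variational, (45)–(46) p.285; Balaban1985BackgroundPropagators, (3.26) p.395, (3.8)–(3.11) p.392] -/
theorem exists_flat_section_energy (hnK : n < K) (a₀ : ℝ)
    (Δx : GaugeField (F.P K) 0 (Matrix.specialUnitaryGroup (Fin 2) ℂ) → (BondL2K ℂ 3 (periodsT3 F K) c₀ W₂ →ₗ[ℂ] BondL2K ℂ 3 (periodsT3 F K) c₀ W₂))
    (hΔ : Δx 1 = (DeltaEta F n K c₀ 1 : BondL2K ℂ 3 (periodsT3 F K) c₀ W₂ →ₗ[ℂ] BondL2K ℂ 3 (periodsT3 F K) c₀ W₂))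
    (y : WL2 ℂ (fun _ : PBond (F.P n) 0 => cB) W₂) :
    ∃ X : PBond (F.P K) 0 → Matrix (Fin 2) (Fin 2) ℂ,
      Qk F n K hnK.le c₀ cB (1 : GaugeField (F.P K) 0 (Matrix.specialUnitaryGroup (Fin 2) ℂ)) (toL2 F K c₀ X) = y ∧
      RCLike.re ⟪toL2 F K c₀ X, laplaceA F n K hnK.le c₀ cB (a₀ * (c₀ / cB) * ((F.L : ℝ) ^ (K - n)) ^ 3) Δx
          (1 : GaugeField (F.P K) 0 (Matrix.specialUnitaryGroup (Fin 2) ℂ)) (toL2 F K c₀ X)⟫_ℂ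
        ≤ (c₀ / cB) * ((F.L : ℝ) ^ (K - n)) ^ 3 * (2721600 + a₀) * ‖y‖ ^ 2 := by
  classical
  have hc₀ : 0 < c₀ := Fact.out
  have hcB : 0 < cB := Fact.out
  have hcBne : cB ≠ 0 := hcB.ne'
  have hL : (0 : ℝ) < F.L := by exact_mod_cast lt_trans zero_lt_one F.hL.2
  set ℓ : ℝ := (F.L : ℝ) ^ (K - n) with hℓ
  have hℓ0 : 0 < ℓ := by positivity
  have hℓne : ℓ ≠ 0 := hℓ0.ne'
  have hη : (eta F n K)⁻¹ = ℓ := by rw [eta, inv_pow, inv_inv]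
  -- the block field read on the level-`(K−n)` bonds of the fine torus
  set e := T3LevelShift.bondShift (T3PrintedRegularOrbits.sites_eq F n K hnK.le) with he
  set B : PBond (F.P n) 0 → Matrix (Fin 2) (Fin 2) ℂ := (toL2B F n cB).symm y with hB
  set Z : PBond (F.P K) (K - n) → Matrix (Fin 2) (Fin 2) ℂ := fun c => B (e.symm c) with hZ
  set Zre : PBond (F.P K) (K - n) → Fin 2 × Fin 2 → ℝ := fun c ii => (Z c ii.1 ii.2).re with hZre
  set Zim : PBond (F.P K) (K - n) → Fin 2 × Fin 2 → ℝ := fun c ii => (Z c ii.1 ii.2).im with hZim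
  -- ★p1's smooth right inverse of `Q_{K−n}` on the real components
  obtain ⟨H, hH⟩ := exists_smoothRightInverse_bondAvgIter_pi_T3 (ι := Fin 2 × Fin 2) F n K
  set X : PBond (F.P K) 0 → Matrix (Fin 2) (Fin 2) ℂ := fun b => Matrix.of fun i i' => (⟨H Zre b (i, i'), H Zim b (i, i')⟩ : ℂ) with hX
  have hXre : ∀ (b : PBond (F.P K) 0) (i i' : Fin 2), (X b i i').re = H Zre b (i, i') := fun _ _ _ => rfl
  have hXim : ∀ (b : PBond (F.P K) 0) (i i' : Fin 2), (X b i i').im = H Zim b (i, i') := fun _ _ _ => rfl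
  -- `Q_{K−n} X = Z` entrywise
  have hQX : bondAvgIter (K - n) X = Z := by
    funext c
    ext i i'
    apply Complex.ext
    · have h1 : (bondAvgIter (K - n) X c i i').re = bondAvgIter (K - n) (fun b => (X b i i').re) c :=
        (ChartHInv.bondAvgIter_comp_apply (Complex.reLm ∘ₗ Matrix.entryLinearMap ℝ ℂ i i') (K - n) X c).symm
      have h2 : bondAvgIter (K - n) (fun b => H Zre b (i, i')) c = bondAvgIter (K - n) (H Zre) c (i, i') :=
        ChartHInv.bondAvgIter_comp_apply (LinearMap.proj (R := ℝ) (φ := fun _ : Fin 2 × Fin 2 => ℝ) (i, i')) (K - n) (H Zre) c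
      rw [h1]
      simp only [hXre]
      rw [h2, (hH Zre).1]
    · have h1 : (bondAvgIter (K - n) X c i i').im = bondAvgIter (K - n) (fun b => (X b i i').im) c :=
        (ChartHInv.bondAvgIter_comp_apply (Complex.imLm ∘ₗ Matrix.entryLinearMap ℝ ℂ i i') (K - n) X c).symm
      have h2 : bondAvgIter (K - n) (fun b => H Zim b (i, i')) c = bondAvgIter (K - n) (H Zim) c (i, i') :=
        ChartHInv.bondAvgIter_comp_apply (LinearMap.proj (R := ℝ) (φ := fun _ : Fin 2 × Fin 2 => ℝ) (i, i')) (K - n) (H Zim) c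
      rw [h1]
      simp only [hXim]
      rw [h2, (hH Zim).1]
  -- hence `Q_k(1)(toL2 X) = y`
  have hQ : Qk F n K hnK.le c₀ cB (1 : GaugeField (F.P K) 0 (Matrix.specialUnitaryGroup (Fin 2) ℂ)) (toL2 F K c₀ X) = y := by
    rw [Qk_one_toL2, hQX, ← he]
    have hZe : (fun c : PBond (F.P n) 0 => Z (e c)) = B := by
      funext c
      show B (e.symm (e c)) = B c
      rw [Equiv.symm_apply_apply]
    rw [hZe, hB, LinearEquiv.apply_symm_apply]
  refine ⟨X, hQ, ?_⟩
  -- the block norm of `y` in real components: `‖y‖² = cB·Σ_c Σ_{ii′} (re² + im²)`, re-indexed on the fine torus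
  have hy : ‖y‖ ^ 2 = cB * (∑ c : PBond (F.P K) (K - n), ∑ ii : Fin 2 × Fin 2, Zre c ii ^ 2 + ∑ c : PBond (F.P K) (K - n), ∑ ii : Fin 2 × Fin 2, Zim c ii ^ 2) := by
    have h1 : ‖y‖ ^ 2 = ‖toL2B F n cB B‖ ^ 2 := by rw [hB, LinearEquiv.apply_symm_apply]
    rw [h1, norm_sq_toL2B, ← Finset.sum_add_distrib]
    congr 1
    refine Fintype.sum_equiv e _ _ (fun c => ?_)
    simp only [hZre, hZim, hZ, Equiv.symm_apply_apply]
    simp only [Fintype.sum_prod_type, ← Finset.sum_add_distrib]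
    refine Finset.sum_congr rfl fun i _ => Finset.sum_congr rfl fun i' _ => ?_
    rw [Complex.sq_norm, Complex.normSq_apply]; ring
  set S : ℝ := ∑ c : PBond (F.P K) (K - n), ∑ ii : Fin 2 × Fin 2, Zre c ii ^ 2 + ∑ c : PBond (F.P K) (K - n), ∑ ii : Fin 2 × Fin 2, Zim c ii ^ 2 with hS
  have hS0 : 0 ≤ S := by positivity
  -- the gradient-`ℓ²` rows of the two real lifts
  set G : (PBond (F.P K) 0 → Fin 2 × Fin 2 → ℝ) → ℝ :=
    fun f => ∑ b : PBond (F.P K) 0, ∑ ρ : Fin 3, ∑ ii : Fin 2 × Fin 2, (f ⟨b.src.shift ρ, b.dir⟩ ii - f b ii) ^ 2 with hG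
  have hGre : G (H Zre) ≤ 388800 * ℓ ^ 3 * (ℓ ^ 2)⁻¹ * ∑ c : PBond (F.P K) (K - n), ∑ ii : Fin 2 × Fin 2, Zre c ii ^ 2 := (hH Zre).2.2.2.2
  have hGim : G (H Zim) ≤ 388800 * ℓ ^ 3 * (ℓ ^ 2)⁻¹ * ∑ c : PBond (F.P K) (K - n), ∑ ii : Fin 2 × Fin 2, Zim c ii ^ 2 := (hH Zim).2.2.2.2
  have hGsum : G (H Zre) + G (H Zim) ≤ 388800 * ℓ * S := by
    have h3 : 388800 * ℓ ^ 3 * (ℓ ^ 2)⁻¹ = 388800 * ℓ := by field_simp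
    rw [h3] at hGre hGim
    rw [hS, mul_add]
    exact add_le_add hGre hGim
  -- per real component: the gradient sum of the component is a slice of `G`
  have hGslice : ∀ (f : PBond (F.P K) 0 → Fin 2 × Fin 2 → ℝ),
      ∑ i : Fin 2, ∑ i' : Fin 2, ∑ b : PBond (F.P K) 0, ∑ ρ : Fin 3, (f ⟨b.src.shift ρ, b.dir⟩ (i, i') - f b (i, i')) ^ 2 = G f := by
    intro f
    show _ = ∑ b : PBond (F.P K) 0, ∑ ρ : Fin 3, ∑ ii : Fin 2 × Fin 2, (f ⟨b.src.shift ρ, b.dir⟩ ii - f b ii) ^ 2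
    rw [← Fintype.sum_prod_type (f := fun ii : Fin 2 × Fin 2 => ∑ b : PBond (F.P K) 0, ∑ ρ : Fin 3, (f ⟨b.src.shift ρ, b.dir⟩ ii - f b ii) ^ 2)]
    rw [Finset.sum_comm]
    exact Finset.sum_congr rfl fun b _ => Finset.sum_comm
  -- TERM 1: the Wilson Hessian `re⟪toL2 X, Δ^η(1) toL2 X⟫ ≤ c₀·ℓ²·4·(G re + G im)`
  have hT1 : RCLike.re ⟪toL2 F K c₀ X, Δx 1 (toL2 F K c₀ X)⟫_ℂ ≤ c₀ * ℓ ^ 2 * (4 * (G (H Zre) + G (H Zim))) := by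
    rw [LinearMap.congr_fun hΔ (toL2 F K c₀ X), ContinuousLinearMap.coe_coe, re_inner_DeltaEta_one_re_im, hη]
    have hb : ∑ i : Fin 2, ∑ i' : Fin 2, (∑ p : Plaq (F.P K) 0, curl 1 (fun b => (X b i i').re) p ^ 2 + ∑ p : Plaq (F.P K) 0, curl 1 (fun b => (X b i i').im) p ^ 2)
        ≤ 4 * (G (H Zre) + G (H Zim)) := by
      calc ∑ i : Fin 2, ∑ i' : Fin 2, (∑ p : Plaq (F.P K) 0, curl 1 (fun b => (X b i i').re) p ^ 2 + ∑ p : Plaq (F.P K) 0, curl 1 (fun b => (X b i i').im) p ^ 2)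
          ≤ ∑ i : Fin 2, ∑ i' : Fin 2, (4 * ∑ b : PBond (F.P K) 0, ∑ ρ : Fin 3, (H Zre ⟨b.src.shift ρ, b.dir⟩ (i, i') - H Zre b (i, i')) ^ 2
              + 4 * ∑ b : PBond (F.P K) 0, ∑ ρ : Fin 3, (H Zim ⟨b.src.shift ρ, b.dir⟩ (i, i') - H Zim b (i, i')) ^ 2) := by
            refine Finset.sum_le_sum fun i _ => Finset.sum_le_sum fun i' _ => ?_
            simp only [hXre, hXim]
            exact add_le_add (sum_curl_one_sq_le (P := F.P K) (j := 0) (fun b => H Zre b (i, i')))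
              (sum_curl_one_sq_le (P := F.P K) (j := 0) (fun b => H Zim b (i, i')))
        _ = 4 * (G (H Zre) + G (H Zim)) := by
            rw [← hGslice (H Zre), ← hGslice (H Zim)]
            simp only [Finset.sum_add_distrib, Finset.mul_sum, mul_add]
    have h0 : 0 ≤ c₀ * ℓ ^ 2 := by positivity
    exact mul_le_mul_of_nonneg_left hb h0
  -- TERM 2: the gauge penalty `‖R_S(1) D*(1) toL2 X‖² ≤ ‖D*(1) toL2 X‖² ≤ c₀·ℓ²·3·(G re + G im)`
  have hT2 : ‖RS F n K hnK.le c₀ cB (1 : GaugeField (F.P K) 0 (Matrix.specialUnitaryGroup (Fin 2) ℂ))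
        (DstarL2 F n K c₀ (1 : GaugeField (F.P K) 0 (Matrix.specialUnitaryGroup (Fin 2) ℂ)) (toL2 F K c₀ X))‖ ^ 2
      ≤ c₀ * ℓ ^ 2 * (3 * (G (H Zre) + G (H Zim))) := by
    set z := DstarL2 F n K c₀ (1 : GaugeField (F.P K) 0 (Matrix.specialUnitaryGroup (Fin 2) ℂ)) (toL2 F K c₀ X) with hz
    have hRz : ‖RS F n K hnK.le c₀ cB (1 : GaugeField (F.P K) 0 (Matrix.specialUnitaryGroup (Fin 2) ℂ)) z‖ ^ 2 ≤ ‖z‖ ^ 2 :=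
      pow_le_pow_left₀ (norm_nonneg _) (norm_RS_le _ z) 2
    refine hRz.trans ?_
    -- `z = toL2S (η⁻¹ • ∂*₁ X)`
    have hz' : z = toL2S F K c₀ (fun x => (((eta F n K : ℝ) : ℂ)⁻¹) • diverg 1 X x) := by
      rw [← (toL2S F K c₀).apply_symm_apply z]
      congr 1
      funext x
      rw [hz, DstarL2_one_apply]
    rw [hz', norm_sq_toL2S]
    -- entrywise: `‖(η⁻¹•M) i i′‖² = ℓ²·(re² + im²)`, and `re∕im` commute with `∂*₁`
    have hent : ∀ (x : Site (F.P K) 0) (i i' : Fin 2),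
        ‖((((eta F n K : ℝ) : ℂ)⁻¹) • diverg 1 X x) i i'‖ ^ 2
          = ℓ ^ 2 * (diverg 1 (fun b => H Zre b (i, i')) x ^ 2 + diverg 1 (fun b => H Zim b (i, i')) x ^ 2) := by
      intro x i i'
      have hre : (diverg 1 X x i i').re = diverg 1 (fun b => H Zre b (i, i')) x :=
        map_diverg_one (Complex.reLm ∘ₗ Matrix.entryLinearMap ℝ ℂ i i') X x
      have him : (diverg 1 X x i i').im = diverg 1 (fun b => H Zim b (i, i')) x :=
        map_diverg_one (Complex.imLm ∘ₗ Matrix.entryLinearMap ℝ ℂ i i') X x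
      rw [Matrix.smul_apply, norm_smul, mul_pow, ← Complex.ofReal_inv, Complex.norm_real, Real.norm_eq_abs, sq_abs, hη,
        Complex.sq_norm, Complex.normSq_apply, hre, him]
      ring
    simp only [hent, ← Finset.mul_sum]
    have hcomp : ∀ i i' : Fin 2,
        ∑ x : Site (F.P K) 0, (diverg 1 (fun b => H Zre b (i, i')) x ^ 2 + diverg 1 (fun b => H Zim b (i, i')) x ^ 2)
          ≤ 3 * ∑ b : PBond (F.P K) 0, ∑ ρ : Fin 3, (H Zre ⟨b.src.shift ρ, b.dir⟩ (i, i') - H Zre b (i, i')) ^ 2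
            + 3 * ∑ b : PBond (F.P K) 0, ∑ ρ : Fin 3, (H Zim ⟨b.src.shift ρ, b.dir⟩ (i, i') - H Zim b (i, i')) ^ 2 := by
      intro i i'
      rw [Finset.sum_add_distrib]
      have h3 : ((F.P K).d : ℝ) = 3 := by norm_num [T3Family.P_d]
      have hre := sum_diverg_one_sq_le (P := F.P K) (j := 0) (fun b => H Zre b (i, i'))
      have him := sum_diverg_one_sq_le (P := F.P K) (j := 0) (fun b => H Zim b (i, i'))
      rw [h3] at hre him
      exact add_le_add hre him
    have hdiv : ∑ x : Site (F.P K) 0, ∑ i : Fin 2, ∑ i' : Fin 2, (diverg 1 (fun b => H Zre b (i, i')) x ^ 2 + diverg 1 (fun b => H Zim b (i, i')) x ^ 2)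
        ≤ 3 * (G (H Zre) + G (H Zim)) := by
      calc ∑ x : Site (F.P K) 0, ∑ i : Fin 2, ∑ i' : Fin 2, (diverg 1 (fun b => H Zre b (i, i')) x ^ 2 + diverg 1 (fun b => H Zim b (i, i')) x ^ 2)
          = ∑ i : Fin 2, ∑ i' : Fin 2, ∑ x : Site (F.P K) 0, (diverg 1 (fun b => H Zre b (i, i')) x ^ 2 + diverg 1 (fun b => H Zim b (i, i')) x ^ 2) := by
            rw [Finset.sum_comm]
            exact Finset.sum_congr rfl fun i _ => Finset.sum_comm
        _ ≤ ∑ i : Fin 2, ∑ i' : Fin 2, (3 * ∑ b : PBond (F.P K) 0, ∑ ρ : Fin 3, (H Zre ⟨b.src.shift ρ, b.dir⟩ (i, i') - H Zre b (i, i')) ^ 2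
            + 3 * ∑ b : PBond (F.P K) 0, ∑ ρ : Fin 3, (H Zim ⟨b.src.shift ρ, b.dir⟩ (i, i') - H Zim b (i, i')) ^ 2) :=
            Finset.sum_le_sum fun i _ => Finset.sum_le_sum fun i' _ => hcomp i i'
        _ = 3 * (G (H Zre) + G (H Zim)) := by
            rw [← hGslice (H Zre), ← hGslice (H Zim)]
            simp only [Finset.sum_add_distrib, Finset.mul_sum, mul_add]
    have h0 : 0 ≤ c₀ * ℓ ^ 2 := by positivity
    calc c₀ * (ℓ ^ 2 * ∑ x : Site (F.P K) 0, ∑ i : Fin 2, ∑ i' : Fin 2, (diverg 1 (fun b => H Zre b (i, i')) x ^ 2 + diverg 1 (fun b => H Zim b (i, i')) x ^ 2))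
        = c₀ * ℓ ^ 2 * ∑ x : Site (F.P K) 0, ∑ i : Fin 2, ∑ i' : Fin 2, (diverg 1 (fun b => H Zre b (i, i')) x ^ 2 + diverg 1 (fun b => H Zim b (i, i')) x ^ 2) := by
          ring
      _ ≤ c₀ * ℓ ^ 2 * (3 * (G (H Zre) + G (H Zim))) := mul_le_mul_of_nonneg_left hdiv h0
  -- TERM 3: the averaging penalty `a·‖Q_k(1) toL2 X‖² = a·‖y‖²`
  have hT3 : a₀ * (c₀ / cB) * ℓ ^ 3 * ‖Qk F n K hnK.le c₀ cB (1 : GaugeField (F.P K) 0 (Matrix.specialUnitaryGroup (Fin 2) ℂ)) (toL2 F K c₀ X)‖ ^ 2 = a₀ * (c₀ / cB) * ℓ ^ 3 * ‖y‖ ^ 2 := by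
    rw [hQ]
  -- assembly
  have hGy : c₀ * ℓ ^ 2 * (7 * (G (H Zre) + G (H Zim))) ≤ (c₀ / cB) * ℓ ^ 3 * 2721600 * ‖y‖ ^ 2 := by
    calc c₀ * ℓ ^ 2 * (7 * (G (H Zre) + G (H Zim))) ≤ c₀ * ℓ ^ 2 * (7 * (388800 * ℓ * S)) := by gcongr
      _ = (c₀ / cB) * ℓ ^ 3 * 2721600 * (cB * S) := by
          field_simp
          ring
      _ = (c₀ / cB) * ℓ ^ 3 * 2721600 * ‖y‖ ^ 2 := by rw [hy]
  rw [re_inner_laplaceA, hT3]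
  linarith [hT1, hT2, hGy]

end Member

end Summit.QuantumFields.YangMills.Theorems.Prop7FlatGramSection

end
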